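import Literature.AlgebraicGeometry.HodgeTheory.AnalytifiedVectorBundle
import Literature.AlgebraicGeometry.Modules.FrameTransition
import Literature.AlgebraicGeometry.Modules.VectorBundleFiniteLocallyFree
import HarnessLib

/-!
# Trivialisations `𝒪^I ≅ E|_W` give frames of sections; vector bundles are finite locally free on sections

The Stacks project, Tag 01C6 (Modules, Def. 17.14.1 and Lemma 17.14.3 ff.): an `𝒪_X`-module `E` is
finite locally free iff every point has an open neighbourhood `W` with `E|_W ≅ 𝒪_W^I`, `I` finite;
then the images `b_i ∈ Γ(E, W)` of the standard sections restrict, over EVERY open `V ≤ W`, to a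
basis of the `Γ(X, V)`-module `Γ(E, V)` (J.-P. Serre, FAC n°41: "faisceau algébrique localement
libre ... isomorphe à `𝒪_U^r`"). The tree has both languages: Mathlib-style trivialisations
`e : SheafOfModules.free I ≅ E.over W` with their basis sections and coordinates
(`Modules/SheafHomExact`, `Modules/LocalFrames`, `Modules/FrameTransition`:
`basisSection`, `coord`, `eq_sum_coord_smul`, `coord_sum_smul_basisSection`) and the Hodge-theory
side's frames ON SECTIONS `HodgeTheory.IsSectionFrame F U s` / `IsFinLocallyFreeOn F U`
(`HodgeTheory/AnalytifiedVectorBundle`, consumed by the analytification of algebraic vector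
bundles). This file is the dictionary between them:

* `isSectionFrame_basisSection` — the basis sections of a trivialisation `e : 𝒪^I ≅ E|_W`, in any
  enumeration `I ≃ Fin r`, form an `IsSectionFrame` of `E` over `W`;
* `isFinLocallyFreeOn_top_of_isFiniteLocallyFree`, `isFinLocallyFreeOn_top_of_isVectorBundle`,
  `isFinLocallyFreeOn_top_of_hasRankLE` — `Motives.IsFiniteLocallyFree E`, `Motives.IsVectorBundle E`
  (Mathlib's `IsLocallyFree ∧ IsFiniteType`) and `Motives.HasRankLE E r` all give
  `IsFinLocallyFreeOn E ⊤`; `exists_isSectionFrame_card_le_of_hasRankLE` keeps the bound `≤ r` on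
  the size of the frames.

Everything is proved; no definitions, no named facts.

## References

* The Stacks project, Tag 01C6 (Modules, §17.14). [StacksProject]
* J.-P. Serre, *Faisceaux algébriques cohérents*, Ann. of Math. 61 (1955), n°41. [SerreFAC1955]
-/

noncomputable section

open CategoryTheory AlgebraicGeometry Opposite TopologicalSpace
open Literature.AlgebraicGeometry.Modules Literature.AlgebraicGeometry.Motives

universe u

namespace Literature.AlgebraicGeometry.HodgeTheory

variable {X : Scheme.{u}} {E : X.Modules} {W : X.Opens} {I : Type u}

/-- **The basis sections of a trivialisation restrict to a basis over every smaller open**: for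
`e : 𝒪^I ≅ E|_W` (`I` finite) and `V ≤ W`, the sections `b_i|_V` are `Γ(X, V)`-linearly independent
(apply the coordinate functionals `λ_j`, `coord_sum_smul_basisSection`) and span `Γ(E, V)`
(`s = Σ λ_i(s) b_i|_V`, `eq_sum_coord_smul`). [cite: StacksProject, Tag 01C6] -/
theorem linearIndependent_and_span_map_basisSection [Fintype I] (e : SheafOfModules.free I ≅ E.over W)
    {V : X.Opens} (hV : V ≤ W) :
    LinearIndependent Γ(X, V) (fun i ↦ E.presheaf.map (homOfLE hV).op (basisSection e i)) ∧
      ⊤ ≤ Submodule.span Γ(X, V) (Set.range fun i ↦ E.presheaf.map (homOfLE hV).op (basisSection e i)) := by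
  refine ⟨Fintype.linearIndependent_iff.2 fun c hc i ↦ ?_, fun s _ ↦ ?_⟩
  · have h := coord_sum_smul_basisSection e (homOfLE hV) c i
    rw [hc, coord_zero] at h
    exact h.symm
  · rw [eq_sum_coord_smul e (homOfLE hV) s]
    exact Submodule.sum_mem _ fun i _ ↦ Submodule.smul_mem _ _ (Submodule.subset_span ⟨i, rfl⟩)

/-- **A trivialisation `𝒪^I ≅ E|_W` gives a section frame of `E` over `W`** (in any enumeration
`I ≃ Fin r` of the finite index set). [cite: StacksProject, Tag 01C6] [cite: SerreFAC1955, n°41] -/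
theorem isSectionFrame_basisSection {r : ℕ} (e : SheafOfModules.free I ≅ E.over W) (ε : I ≃ Fin r) :
    IsSectionFrame E W (fun k ↦ basisSection e (ε.symm k)) := by
  haveI : Fintype I := Fintype.ofEquiv _ ε.symm
  intro V hV
  obtain ⟨hli, hsp⟩ := linearIndependent_and_span_map_basisSection e hV
  refine ⟨hli.comp _ ε.symm.injective, ?_⟩
  have hr : (Set.range fun k : Fin r ↦ E.presheaf.map (homOfLE hV).op (basisSection e (ε.symm k))) =
      Set.range fun i ↦ E.presheaf.map (homOfLE hV).op (basisSection e i) :=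
    ε.symm.surjective.range_comp (fun i ↦ E.presheaf.map (homOfLE hV).op (basisSection e i))
  rw [hr]
  exact hsp

/-- **Finite locally free (trivialisations `𝒪^I ≅ E|_W`, `I` finite, near every point) ⟹ finite
locally free on sections over `X`.** [cite: StacksProject, Tag 01C6] -/
theorem isFinLocallyFreeOn_top_of_isFiniteLocallyFree (h : IsFiniteLocallyFree E) : IsFinLocallyFreeOn E ⊤ := by
  intro x _
  obtain ⟨U, hxU, I, hI, ⟨e⟩⟩ := h x
  haveI := Fintype.ofFinite I
  exact ⟨U, Fintype.card I, fun k ↦ basisSection e ((Fintype.equivFin I).symm k), hxU, le_top,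
    isSectionFrame_basisSection e (Fintype.equivFin I)⟩

/-- **A vector bundle (Mathlib: locally free and of finite type) is finite locally free on sections.**
[cite: StacksProject, Tag 01C6] -/
theorem isFinLocallyFreeOn_top_of_isVectorBundle (h : IsVectorBundle E) : IsFinLocallyFreeOn E ⊤ :=
  isFinLocallyFreeOn_top_of_isFiniteLocallyFree (isFiniteLocallyFree_of_isVectorBundle h)

/-- **A module of rank `≤ r` is finite locally free on sections.** [cite: StacksProject, Tag 01C6] -/
theorem isFinLocallyFreeOn_top_of_hasRankLE {r : ℕ} (h : HasRankLE E r) : IsFinLocallyFreeOn E ⊤ :=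
  isFinLocallyFreeOn_top_of_isFiniteLocallyFree h.isFiniteLocallyFree

/-- **A module of rank `≤ r` has, near every point, a section frame of size `≤ r`** (the local
trivialisations of a `HasRankLE` datum have index sets of cardinality `≤ r`).
[cite: StacksProject, Tag 01C6] -/
theorem exists_isSectionFrame_card_le_of_hasRankLE {r : ℕ} (h : HasRankLE E r) (x : X) :
    ∃ (U : X.Opens) (r' : ℕ) (s : Fin r' → Γ(E, U)), r' ≤ r ∧ x ∈ U ∧ IsSectionFrame E U s := by
  obtain ⟨q, hq, hr⟩ := h
  obtain ⟨a, ha⟩ := ((Opens.coversTop_iff _ q.X).mp q.coversTop).exists_mem x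
  haveI : Finite (q.generators a).I := (hr a).1
  haveI := Fintype.ofFinite (q.generators a).I
  haveI := hq.isIso a
  refine ⟨q.X a, Fintype.card (q.generators a).I,
    fun k ↦ basisSection (asIso (q.generators a).π) ((Fintype.equivFin _).symm k), ?_, ha,
    isSectionFrame_basisSection (asIso (q.generators a).π) (Fintype.equivFin _)⟩
  rw [← Nat.card_eq_fintype_card]
  exact (hr a).2

set_option maxHeartbeats 400000 in
/-- **Every member of a locally free datum carries a section frame of the size of its index set**:
for `q` local generators data of `E` which are locally free (Mathlib `IsLocallyFreeData`: the maps
`𝒪^{I_a} → E|_{U_a}` are isomorphisms) and `a` with `I_a` finite, `E` has an `IsSectionFrame` of size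
`#I_a` over `U_a`. [cite: StacksProject, Tag 01C6] -/
theorem exists_isSectionFrame_of_isLocallyFreeData (q : SheafOfModules.LocalGeneratorsData.{u} (R := X.ringCatSheaf) E)
    [hq : q.IsLocallyFreeData] (a : q.I) [hI : Fintype (q.generators a).I] :
    ∃ s : Fin (Fintype.card (q.generators a).I) → Γ(E, q.X a), IsSectionFrame E (q.X a) s :=
  ⟨fun k ↦ basisSection (asIso (q.generators a).π) ((Fintype.equivFin _).symm k),
    isSectionFrame_basisSection (asIso (q.generators a).π) (Fintype.equivFin _)⟩

/-- **The trivial bundle `𝒪_X^I` (`I` finite) has a GLOBAL section frame of size `#I`**: the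
tautological trivialisation of `SheafOfModules.free I` on the trivial cover (Mathlib's
`free.generatingSections`, locally free data), at the member `⊤`. [cite: StacksProject, Tag 01C6] -/
theorem exists_isSectionFrame_top_free (X : Scheme.{u}) (I : Type u) [Fintype I] :
    ∃ s : Fin (Fintype.card I) → Γ((SheafOfModules.free (R := X.ringCatSheaf) I : X.Modules), ⊤),
      IsSectionFrame (SheafOfModules.free (R := X.ringCatSheaf) I : X.Modules) ⊤ s :=
  exists_isSectionFrame_of_isLocallyFreeData (E := (SheafOfModules.free (R := X.ringCatSheaf) I : X.Modules))
    (SheafOfModules.free.generatingSections (R := X.ringCatSheaf) I).localGeneratorsData (⊤ : X.Opens)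
    (hI := (inferInstance : Fintype I))

/-- Morphisms of `𝒪_X`-modules commute with restriction on sections. [cite: StacksProject, Tag 01C6] -/
theorem app_presheaf_map {F F' : X.Modules} (ψ : F ⟶ F') {U V : X.Opens} (i : V ⟶ U) (s : Γ(F, U)) :
    ψ.app V (F.presheaf.map i.op s) = F'.presheaf.map i.op (ψ.app U s) :=
  PresheafOfModules.naturality_apply ψ.val i.op s

/-- **Frames are transported by isomorphisms of modules**: if `s` is a section frame of `F` over `U`
and `φ : F ≅ F'`, then `φ_U ∘ s` is a section frame of `F'` over `U`. [cite: StacksProject, Tag 01C6] -/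
theorem IsSectionFrame.map_iso {F F' : X.Modules} (φ : F ≅ F') {U : X.Opens} {r : ℕ} {s : Fin r → Γ(F, U)}
    (hs : IsSectionFrame F U s) : IsSectionFrame F' U (fun i ↦ φ.hom.app U (s i)) := by
  intro V hV
  obtain ⟨hli, hsp⟩ := hs hV
  -- `φ_V` as a `Γ(X, V)`-linear equivalence `Γ(F, V) ≃ Γ(F', V)`
  let L : Γ(F, V) ≃ₗ[Γ(X, V)] Γ(F', V) :=
    { toFun := φ.hom.app V
      invFun := φ.inv.app V
      map_add' := map_add _
      map_smul' := Scheme.Modules.Hom.app_smul φ.hom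
      left_inv := fun t ↦ by
        change (φ.hom.app V ≫ φ.inv.app V) t = t
        rw [← Scheme.Modules.Hom.comp_app, φ.hom_inv_id, Scheme.Modules.Hom.id_app]
        rfl
      right_inv := fun t ↦ by
        change (φ.inv.app V ≫ φ.hom.app V) t = t
        rw [← Scheme.Modules.Hom.comp_app, φ.inv_hom_id, Scheme.Modules.Hom.id_app]
        rfl }
  have hfam : (fun i ↦ F'.presheaf.map (homOfLE hV).op (φ.hom.app U (s i))) =
      L ∘ fun i ↦ F.presheaf.map (homOfLE hV).op (s i) := by
    funext i
    exact (app_presheaf_map φ.hom (homOfLE hV) (s i)).symm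
  rw [hfam]
  refine ⟨hli.map' L.toLinearMap L.ker, ?_⟩
  rw [Set.range_comp, ← LinearEquiv.coe_toLinearMap, ← Submodule.map_span, eq_top_iff.2 hsp, Submodule.map_top,
    LinearMap.range_eq_top.2 L.surjective]

/-- Frames of size `r` near every point are transported by isomorphisms of modules. [cite: StacksProject, Tag 01C6] -/
theorem exists_isSectionFrame_of_iso {F F' : X.Modules} (φ : F ≅ F') {r : ℕ}
    (hF : ∀ x : X, ∃ (U : X.Opens) (s : Fin r → Γ(F, U)), x ∈ U ∧ IsSectionFrame F U s) (x : X) :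
    ∃ (U : X.Opens) (s : Fin r → Γ(F', U)), x ∈ U ∧ IsSectionFrame F' U s := by
  obtain ⟨U, s, hx, hs⟩ := hF x
  exact ⟨U, fun i ↦ φ.hom.app U (s i), hx, hs.map_iso φ⟩

end Literature.AlgebraicGeometry.HodgeTheory



end
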